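import Summits.Ventures.QEC.Census.RankCert
import HarnessLib

/-!
# Classical distance certificates in the kernel: `d(ker H) = d`, `d(ker Hᵀ) = dᵀ` (or `⊤`) for a row-list matrix

LADDER-QEC (venture cell `qec`), PARTITION v2.3 item 04.HGPK (HGP KERNEL PIPELINE, director-qec D11
2026-08-26T19:06:38Z: "classical seed-distance certificates for `ker H₁, ker H₂, ker H₁ᵀ, ker H₂ᵀ` … by decide via
type-10's scan with empty stabiliser list"). This file is exactly that: the CLASSICAL special case of the CSS
distance checker of `Census/CertCheck.lean` (type-10). For a binary matrix given as a row list `H : List ℕ` over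
`n` columns (`rowMatrix n H`, bit `j` of `H[i]` = entry `(i, j)`), a `SideCert` `s = {d, witness, nonmember, found}`
checked by `DistCert.sideOK n H [] s` (syndrome rows `H`, EMPTY stabiliser list) certifies the minimum distance of
the classical code `ker H` in the tree's `ℕ∞` convention (`Literature.InformationTheory.Coding.minDist`):

* `minDist_pcCode_of_sideOK : DistCert.sideOK n H [] s = true → minDist (pcCode (rowMatrix n H)) = s.d` — with no
  stabilisers "logical" means "nonzero codeword", so the checker's upper witness is a codeword of weight `d` and its
  brute-force replay (every word of weight `1 … d−1` has nonzero syndrome; the allow-list must be empty) is the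
  lower bound;
* the TRANSPOSE code `ker Hᵀ` (needed by Tillich–Zémor's `min(d₁, d₂, d₁ᵀ, d₂ᵀ)`): `colWords n H` = the `n` columns
  of `H` as numerals over the rows (`colMask`), `rowMatrix_colWords` (it is `(rowMatrix n H)ᵀ` up to the row cast),
  `minDist_pcCode_transpose_eq` and `minDist_pcCode_transpose_of_sideOK` (a `SideCert` for the column words
  certifies `d(ker Hᵀ)`);
* `pcCode_transpose_eq_bot_of_rankCert` / `minDist_pcCode_transpose_of_rankCert`: a rank certificate
  (`Census/RankCert.lean`, type-02) with `r = |H|` (linearly independent rows) gives `ker Hᵀ = 0`, `d(ker Hᵀ) = ⊤`;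
* `finrank_pcCode_pos_of_minDist_eq` (a finite distance means a nonzero code) and the rank read-out
  `rank_rowMatrix_of_rankCert` (restated interface of `rank_rowMatrix_of_check`);
* controls by `decide` (tier KERNEL): the repetition code `[3,1,3]` (`H = [x₀+x₁, x₁+x₂]`: `d = 3`, full rank,
  `d(ker Hᵀ) = ⊤`) and the Hamming code `[7,4,3]` (`d = 3`), and the `6 × 6` circulant of `1 + x` (`d = dᵀ = 6`).

HONEST FRAMING: nothing here trusts a producer — the checker recomputes syndromes, weights and the full replay; every
discharge below is `decide` (kernel), axioms ⊆ {propext, Classical.choice, Quot.sound}. The consumers are the HGP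
census files `Census/HGP/*.lean` (instances of `Basic/HypergraphProductCensus.lean`). All statements are
elementary linear algebra over `𝔽₂` [folklore]; the certificate FORMAT is plan/CERT-FORMAT.md v1 §3 (one side,
`H_stab = []`).
-/

namespace Summit.Ventures.QEC.Census

open Matrix Literature.InformationTheory.QuantumCodes
open Literature.InformationTheory.Coding (minDist minDist_bot minDist_le_hammingNorm le_minDist_iff)

/-! ## The code of an empty row list, and nonzero-ness -/

/-- The row space of the empty matrix is the zero code. [folklore] -/
theorem rowSpace_rowMatrix_nil (n : ℕ) : rowSpace (rowMatrix n ([] : List ℕ)) = ⊥ := by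
  rw [eq_bot_iff]
  intro v hv
  obtain ⟨y, rfl⟩ := (mem_rowSpace_iff _ _).1 hv
  rw [Submodule.mem_bot]
  funext j
  simp [Matrix.vecMul, dotProduct]

/-- With no stabilisers, "outside the stabiliser row space" means "nonzero". [folklore] -/
theorem not_mem_rowSpace_nil_iff {n : ℕ} (v : Fin n → ZMod 2) :
    v ∉ rowSpace (rowMatrix n ([] : List ℕ)) ↔ v ≠ 0 := by
  rw [rowSpace_rowMatrix_nil, Submodule.mem_bot]

/-! ## Soundness: a one-sided certificate with empty stabiliser list certifies `d(ker H)` -/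

/-- **Classical distance certificate, soundness.** If the one-side check of `Census/CertCheck.lean` passes with
syndrome rows `H` and NO stabiliser rows, then the classical code `ker (rowMatrix n H)` has minimum distance exactly
`s.d` (`ℕ∞`-valued `minDist`; in particular the code is nonzero). [folklore] -/
theorem minDist_pcCode_of_sideOK {n : ℕ} {H : List ℕ} {s : SideCert} (h : DistCert.sideOK n H [] s = true) :
    minDist (pcCode (rowMatrix n H)) = (s.d : ℕ∞) := by
  obtain ⟨v, hv, hv', hwt, hall⟩ := sideOK_sound h
  rw [not_mem_rowSpace_nil_iff] at hv'
  refine le_antisymm ?_ (le_minDist_iff.2 fun c hc hc0 => ?_)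
  · rw [← hwt]
    exact minDist_le_hammingNorm ((mem_pcCode_iff _ _).2 hv) hv'
  · exact_mod_cast hall c ((mem_pcCode_iff _ _).1 hc) ((not_mem_rowSpace_nil_iff c).2 hc0)

/-- A code with finite minimum distance `d(ker H) = d ∈ ℕ` is nonzero: `0 < dim ker H`. [folklore] -/
theorem finrank_pcCode_pos_of_minDist_eq {R Q : Type*} [Fintype R] [Fintype Q] [DecidableEq Q]
    {H : Matrix R Q (ZMod 2)} {d : ℕ} (h : minDist (pcCode H) = (d : ℕ∞)) :
    0 < Module.finrank (ZMod 2) (pcCode H) := by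
  rw [Module.finrank_pos_iff_exists_ne_zero]
  by_contra hne
  have htop : minDist (pcCode H) = ⊤ :=
    top_le_iff.1 (le_minDist_iff.2 fun c hc hc0 =>
      (hne ⟨⟨c, hc⟩, fun h0 => hc0 (congrArg Subtype.val h0)⟩).elim)
  rw [htop] at h
  exact ENat.top_ne_coe d h

/-! ## The transpose code `ker Hᵀ` via the column words -/

/-- The `n` columns of the row list `H`, as numerals over the rows (`bit r` of word `j` = bit `j` of `H[r]`):
the row list of `Hᵀ`. Spelled out (no new definition): `(List.range n).map (colMask H)`. This lemma records its
length. [folklore] -/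
theorem length_map_colMask (n : ℕ) (H : List ℕ) : ((List.range n).map (colMask H)).length = n := by
  simp

/-- **The column-word matrix is the transpose**: `rowMatrix |H| (columns of H)` is `(rowMatrix n H)ᵀ` with its
rows relabelled along `Fin n ≃ Fin |columns|`. [folklore] -/
theorem rowMatrix_map_colMask (n : ℕ) (H : List ℕ) :
    rowMatrix H.length ((List.range n).map (colMask H))
      = ((rowMatrix n H)ᵀ).submatrix (Fin.cast (length_map_colMask n H)) id := by
  ext i r
  simp only [rowMatrix, Matrix.submatrix_apply, Matrix.transpose_apply, id, ofBits, Fin.getElem_fin,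
    List.getElem_map, List.getElem_range, testBit_colMask H i r r.2, Fin.val_cast]
  rfl

/-- Relabelling the rows of a parity-check matrix does not change its code. [folklore] -/
theorem pcCode_submatrix_rows {R R' Q : Type*} [Fintype Q] (A : Matrix R Q (ZMod 2)) (e : R' ≃ R) :
    pcCode (A.submatrix e id) = pcCode A := by
  ext v
  simp only [mem_pcCode_iff]
  constructor
  · intro h
    funext r
    have := congrFun h (e.symm r)
    simpa [Matrix.mulVec, Matrix.submatrix_apply] using this
  · intro h
    funext r'
    have := congrFun h (e r')
    simpa [Matrix.mulVec, Matrix.submatrix_apply] using this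

/-- **`d(ker Hᵀ)` is the distance of the column-word code.** [folklore] -/
theorem minDist_pcCode_transpose_eq (n : ℕ) (H : List ℕ) :
    minDist (pcCode (rowMatrix n H)ᵀ) = minDist (pcCode (rowMatrix H.length ((List.range n).map (colMask H)))) := by
  rw [rowMatrix_map_colMask,
    show (Fin.cast (length_map_colMask n H) : Fin ((List.range n).map (colMask H)).length → Fin n)
        = (finCongr (length_map_colMask n H) : _ ≃ _) from rfl,
    pcCode_submatrix_rows]

/-- **Transpose distance certificate, soundness**: a one-side check on the column words (over `|H|` "columns" =
the rows of `H`) with empty stabiliser list certifies `d(ker Hᵀ) = s.d`. [folklore] -/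
theorem minDist_pcCode_transpose_of_sideOK {n : ℕ} {H : List ℕ} {s : SideCert}
    (h : DistCert.sideOK H.length ((List.range n).map (colMask H)) [] s = true) :
    minDist (pcCode (rowMatrix n H)ᵀ) = (s.d : ℕ∞) := by
  rw [minDist_pcCode_transpose_eq]
  exact minDist_pcCode_of_sideOK h

/-! ## Full row rank: `ker Hᵀ = 0`, `d(ker Hᵀ) = ⊤` -/

/-- **Rank read-out** (interface restatement of type-02's `rank_rowMatrix_of_check` with the claimed rank as an
explicit equation, the shape the HGP census corollaries consume). [folklore] -/
theorem rank_rowMatrix_of_rankCert {n : ℕ} {H : List ℕ} {c : RankCert} {r : ℕ} (h : c.check n H = true)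
    (hr : c.r = r) : (rowMatrix n H).rank = r := by
  rw [← hr]
  exact rank_rowMatrix_of_check h

/-- Linearly independent rows (a rank certificate with `r = |H|`) leave no transpose code: `ker Hᵀ = 0`.
[folklore] -/
theorem pcCode_transpose_eq_bot_of_rankCert {n : ℕ} {H : List ℕ} {c : RankCert} (h : c.check n H = true)
    (hr : c.r = H.length) : pcCode (rowMatrix n H)ᵀ = ⊥ := by
  have hrk : (rowMatrix n H)ᵀ.rank = H.length := by rw [Matrix.rank_transpose, rank_rowMatrix_of_check h, hr]
  have hsum := rank_add_finrank_pcCode (rowMatrix n H)ᵀ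
  rw [hrk, Fintype.card_fin] at hsum
  exact Submodule.finrank_eq_zero.1 (by omega)

/-- **`d(ker Hᵀ) = ⊤` for a full-row-rank certificate** (the tree's convention `d(0) = ∞`, Tillich–Zémor §5).
[folklore] -/
theorem minDist_pcCode_transpose_of_rankCert {n : ℕ} {H : List ℕ} {c : RankCert} (h : c.check n H = true)
    (hr : c.r = H.length) : minDist (pcCode (rowMatrix n H)ᵀ) = ⊤ := by
  rw [pcCode_transpose_eq_bot_of_rankCert h hr, minDist_bot]

/-! ## Controls (tier KERNEL: `decide` only) -/

/-- Repetition code `[3,1,3]`: `H = [x₀+x₁, x₁+x₂]` = rows `[3, 6]`; certificate `d = 3` (witness `111₂ = 7`,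
nonmember `1`, empty allow-list). CONTROL. [folklore] -/
theorem minDist_rep3 : minDist (pcCode (rowMatrix 3 [3, 6])) = (3 : ℕ) :=
  minDist_pcCode_of_sideOK (s := { d := 3, witness := 7, nonmember := 1, found := [] }) (by decide)

/-- Repetition code `[3,1,3]`: rank certificate `r = 2` (pivots rows `0,1`; right-inverse columns `{x₀}, {x₂}`).
CONTROL. [folklore] -/
theorem rank_rep3 : (rowMatrix 3 [3, 6]).rank = 2 :=
  rank_rowMatrix_of_rankCert (c := { r := 2, pivots := [0, 1], rinv := [1, 4], dependent := [] }) (by decide) rfl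

/-- Repetition code `[3,1,3]`: full row rank, so `d(ker Hᵀ) = ⊤`. CONTROL. [folklore] -/
theorem minDist_transpose_rep3 : minDist (pcCode (rowMatrix 3 [3, 6])ᵀ) = ⊤ :=
  minDist_pcCode_transpose_of_rankCert (c := { r := 2, pivots := [0, 1], rinv := [1, 4], dependent := [] })
    (by decide) rfl

/-- Hamming code `[7,4,3]`: `H` = rows `[85, 102, 120]` (columns = binary expansions of `1 … 7`); certificate
`d = 3` (witness `x₀+x₁+x₂ = 7`). CONTROL. [folklore] -/
theorem minDist_ham3 : minDist (pcCode (rowMatrix 7 [85, 102, 120])) = (3 : ℕ) :=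
  minDist_pcCode_of_sideOK (s := { d := 3, witness := 7, nonmember := 1, found := [] }) (by decide)

/-- The `6 × 6` circulant of `1 + x` (checks `xᵢ + xᵢ₊₁ mod 6`, rows `[3, 6, 12, 24, 48, 33]`): `d(ker H) = 6`
(witness `111111₂ = 63`). CONTROL. [folklore] -/
theorem minDist_circ6 : minDist (pcCode (rowMatrix 6 [3, 6, 12, 24, 48, 33])) = (6 : ℕ) :=
  minDist_pcCode_of_sideOK (s := { d := 6, witness := 63, nonmember := 1, found := [] }) (by decide)

/-- The `6 × 6` circulant of `1 + x`: the transpose code also has `d(ker Hᵀ) = 6`, certified on the column words.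
CONTROL. [folklore] -/
theorem minDist_transpose_circ6 : minDist (pcCode (rowMatrix 6 [3, 6, 12, 24, 48, 33])ᵀ) = (6 : ℕ) :=
  minDist_pcCode_transpose_of_sideOK (s := { d := 6, witness := 63, nonmember := 1, found := [] }) (by decide)

/-! ## Appendix (2026-08-26, 04.HGPK): full column rank — the zero code `ker H = 0`, `d(ker H) = ⊤` -/

/-- A rank certificate with `r = n` (rank = number of columns) leaves no code: `ker H = 0`. [folklore] -/
theorem pcCode_eq_bot_of_rankCert {n : ℕ} {H : List ℕ} {c : RankCert} (h : c.check n H = true) (hr : c.r = n) :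
    pcCode (rowMatrix n H) = ⊥ := by
  have hsum := rank_add_finrank_pcCode (rowMatrix n H)
  rw [rank_rowMatrix_of_check h, hr, Fintype.card_fin] at hsum
  exact Submodule.finrank_eq_zero.1 (by omega)

/-- **`d(ker H) = ⊤` for a full-column-rank certificate** (`r = n`; the tree's convention `d(0) = ∞`). Needed for
transposed seeds of full-row-rank matrices in the HGP census. [folklore] -/
theorem minDist_pcCode_of_rankCert_eq_top {n : ℕ} {H : List ℕ} {c : RankCert} (h : c.check n H = true)
    (hr : c.r = n) : minDist (pcCode (rowMatrix n H)) = ⊤ := by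
  rw [pcCode_eq_bot_of_rankCert h hr, minDist_bot]

/-- CONTROL: the transpose of the `[3,1,3]` repetition checks, `Hᵀ = [x₀, x₀+x₁, x₁]` over 2 columns (rows
`[1, 3, 2]`), has rank 2 = number of columns, so `ker Hᵀ = 0` and `d = ⊤`. [folklore] -/
theorem minDist_rep3_cols : minDist (pcCode (rowMatrix 2 [1, 3, 2])) = ⊤ :=
  minDist_pcCode_of_rankCert_eq_top (c := { r := 2, pivots := [0, 2], rinv := [1, 2], dependent := [(1, [0, 1])] })
    (by decide) rfl

end Summit.Ventures.QEC.Census
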